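import Literature.NumberTheory.GaloisRepresentations.IdeleBarKSInflationTrunc
import Literature.NumberTheory.GaloisRepresentations.IdeleTruncatedSUnitsSequence
import Literature.Algebra.Homology.DiscreteRepInvariantsQuotient
import HarnessLib

/-!
# The square `Inf_{N_S}(I_S → C_{K_S}) ≫ (Inf C_{K_S} ↪ C̄) = ι_S ≫ (J̄ ↠ C̄)` in `C_{Γ_K}`
# (the `G_S`-side class map of `I_S` read in `C_{Γ_K}`; Harari §17.4 (17.1), §4.3 Remark 4.24)

Topic `NumberTheory/GaloisRepresentations`; namespace `Literature.NumberTheory.GaloisRepresentations.IdeleClassBar`.  THEOREMS ONLY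
(no definition, no named fact, no instance, no notation, no `sorry`).  Sequel to bsd-eis -w6's `IdeleBarKSInflationTrunc.lean`
(`sharp K S f = f♯`, `ι_S := (𝟙 I_S)♯ : Inf I_S ⟶ J̄`, `sharp_eq_map_comp_sharp_id`), `IdeleTruncatedSUnitsSequence.lean`
(`truncToClassBarSD : I_S ⟶ C̄_S`, Harari's (17.1)), `IdeleBarKSMaps.lean` (`truncIdeleBarToClassKS : I_S ⟶ C_{K_S}`), door-c5's
`GalLayerSystemSES.lean` (`ideleClassLimitShortComplex K : 0 → Ē → J̄ → C̄ → 0` in `C_{Γ_K}`) and -w7 g11's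
`Algebra/Homology/DiscreteRepInvariantsQuotient.lean` (the counit `invariantsInclQuot N X : Inf(X^N) ⟶ X`).

THE MATHEMATICS.  `K` a number field, `S` a finite set of finite places, `N_S ⊴ Γ_K` the ramification subgroup, `G_S = Γ_K ⧸ N_S`,
`Inf = inflKS K S : C_{G_S} ⥤ C_{Γ_K}`.  The `G_S`-modules `I_S` (`truncIdeleBarD`), `C_{K_S} = C̄^{N_S}` (`classBarKSD`) and
`C̄_S = C_{K_S} ⧸ Ū_S` (`classBarSD`) carry the maps `I_S → C_{K_S} ↠ C̄_S` whose composite is the map `g_S` of Harari's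
class-formation sequence (17.1) (`truncToClassBarSD_eq_comp`, definitional).  Read in `C_{Γ_K}`, the first map followed by the
counit `Inf(C̄^{N_S}) ↪ C̄` IS the inflated inclusion `ι_S : Inf I_S ⟶ J̄` followed by the class map `J̄ ↠ C̄`
(**`inflKS_map_truncToClassKSD_comp_invariantsInclQuot`**: both send a vector `x ∈ I_S ⊆ J̄` to its class in `C̄`); with
`f♯ = Inf f ≫ ι_S` this gives, for every `G_S`-morphism `f : X ⟶ I_S`,
**`Inf(f ≫ (I_S → C_{K_S})) ≫ counit = f♯ ≫ (J̄ ↠ C̄)`** (`inflKS_map_comp_truncToClassKSD_comp_invariantsInclQuot`).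
Step (b) of the (R4)_S plan of lane «PT-Ш-S-TC» (`F2D-SCOPING-w6g11.md` §2 (b)): it moves the `C_{G_S}`-side class
`x ∘ [g_S]` (the argument of `inv_S`, via (★1) `inv_S ∘ (C_{K_S} ↠ C̄_S)_* = inv_{K_S}` and (★2) `inv_{K_S} = inv_K ∘ counit_* ∘ Inf`)
onto door-c6's all-places class `· ∘ [f♯ ≫ g]` (the argument of `classBarInv` in the tree's reciprocity law).

Cell bsd-eis, crux `GoodLatticeBDPValue` (stmt-BirchSwinnertonDyer-19032), brick D4b/F2d, seat bsd-line-x1-p1-w5 gen 11.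
HONEST FRAMING: bookkeeping; no duality statement and no case of BSD is proved here.
AI formalisation, weaker than expert review; established only by the kernel check.

## References
* D. Harari, *Galois Cohomology and Class Field Theory*, Universitext, Springer (2020), §17.4 (17.1), §4.3 Remark 4.24,
  Prop. 17.26 (proof). [Harari2020]
* J. S. Milne, *Arithmetic Duality Theorems*, 2nd ed. (2006), I §4, proof of Thm. 4.10 (p. 58), Lemma 4.13. [MilneADT2006]
-/

noncomputable section

open NumberField IsDedekindDomain CategoryTheory CategoryTheory.Abelian
open Field (absoluteGaloisGroup)
open Literature.NumberTheory.Automorphic Literature.Algebra.Homology Literature.Algebra.Homology.DiscreteRep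
open scoped Classical

namespace Literature.NumberTheory.GaloisRepresentations

namespace IdeleClassBar

variable (K : Type) [Field K] [NumberField K] (S : Finset (HeightOneSpectrum (𝓞 K)))

/-! ## §1. `I_S → C_{K_S}` in `C_{G_S}` and the factorisation of `g_S : I_S ⟶ C̄_S` -/

/-- **`I_S → C_{K_S}` as a morphism of `C_{G_S}`** (`truncIdeleBarToClassKS`, -w6's `IdeleBarKSMaps`, between the objects
`truncIdeleBarD` and `classBarKSD`). [cite: Harari2020, §17.4 (17.1)] -/
abbrev truncToClassKSD : truncIdeleBarD K S ⟶ classBarKSD K S :=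
  ObjectProperty.homMk (truncIdeleBarToClassKS K S)

/-- **`g_S = (I_S → C_{K_S}) ≫ (C_{K_S} ↠ C̄_S)`** (definitional): the map `I_S ⟶ C̄_S` of the class-formation sequence (17.1)
factors through `C_{K_S}`. [cite: Harari2020, §17.4 (17.1), Def. 15.38] -/
theorem truncToClassBarSD_eq_comp : truncToClassBarSD K S = truncToClassKSD K S ≫ toClassBarSD K S := rfl

/-- On vectors `I_S → C_{K_S}` is `x ↦ [x]` (the limit class map of `x ∈ I_S ⊆ J̄`, as an `N_S`-invariant of `C̄`).
[cite: Harari2020, §17.4 (17.1)] -/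
theorem truncToClassKSD_hom_hom_apply_coe (x : (truncIdeleBarD K S).obj.V) :
    (((truncToClassKSD K S).hom.hom x).1 : classBar K) =
      (ideleToClass K).limitMap (x.1 : (ideleData K).toSystem.limit) := rfl

/-! ## §2. The square in `C_{Γ_K}` -/

/-- **`Inf(I_S → C_{K_S}) ≫ (Inf(C̄^{N_S}) ↪ C̄) = ι_S ≫ (J̄ ↠ C̄)`** as morphisms `Inf I_S ⟶ C̄` of `C_{Γ_K}`: both send
`x ∈ I_S ⊆ J̄` to its idèle class in `C̄ = lim→ C_E`. [cite: Harari2020, §17.4 (17.1), §4.3 Remark 4.24] -/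
theorem inflKS_map_truncToClassKSD_comp_invariantsInclQuot :
    (inflKS K S).map (truncToClassKSD K S) ≫
        invariantsInclQuot (ramificationSubgroup K (↑S : Set (HeightOneSpectrum (𝓞 K)))) (classBarD K) =
      sharp K S (𝟙 (truncIdeleBarD K S)) ≫ (ideleClassLimitShortComplex K).g :=
  ObjectProperty.hom_ext _ (Rep.hom_ext (DFunLike.ext _ _ fun _ => rfl))

variable {K S} in
/-- **`Inf(f ≫ (I_S → C_{K_S})) ≫ counit = f♯ ≫ (J̄ ↠ C̄)`** for every `G_S`-morphism `f : X ⟶ I_S` (the square after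
`f♯ = Inf f ≫ ι_S`, `sharp_eq_map_comp_sharp_id`). [cite: Harari2020, Prop. 17.26 (proof), §17.4 (17.1)] -/
theorem inflKS_map_comp_truncToClassKSD_comp_invariantsInclQuot
    {X : DiscreteRepCat ℤ (GaloisGroupUnramifiedOutside K (↑S : Set (HeightOneSpectrum (𝓞 K))))} (f : X ⟶ truncIdeleBarD K S) :
    (inflKS K S).map (f ≫ truncToClassKSD K S) ≫
        invariantsInclQuot (ramificationSubgroup K (↑S : Set (HeightOneSpectrum (𝓞 K)))) (classBarD K) =
      sharp K S f ≫ (ideleClassLimitShortComplex K).g :=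
  ObjectProperty.hom_ext _ (Rep.hom_ext (DFunLike.ext _ _ fun _ => rfl))

variable {K S} in
/-- The same on `Ext` classes out of any `A ∈ C_{Γ_K}`: composing a class with `[Inf(f ≫ (I_S → C_{K_S}))]` and then with the
counit `[Inf(C̄^{N_S}) ↪ C̄]` is composing it with `[f♯ ≫ (J̄ ↠ C̄)]`. [cite: Harari2020, §4.3 Remark 4.24][cite: MilneADT2006, I §4 (p. 58)] -/
theorem ext_comp_mk₀_inflKS_map_comp_mk₀_invariantsInclQuot {A : DiscreteRepCat ℤ (absoluteGaloisGroup K)} {n : ℕ}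
    {X : DiscreteRepCat ℤ (GaloisGroupUnramifiedOutside K (↑S : Set (HeightOneSpectrum (𝓞 K))))} (f : X ⟶ truncIdeleBarD K S)
    (x : Ext A ((inflKS K S).obj X) n) :
    (x.comp (Ext.mk₀ ((inflKS K S).map (f ≫ truncToClassKSD K S))) (add_zero n)).comp
        (Ext.mk₀ (invariantsInclQuot (ramificationSubgroup K (↑S : Set (HeightOneSpectrum (𝓞 K)))) (classBarD K))) (add_zero n) =
      x.comp (Ext.mk₀ (sharp K S f ≫ (ideleClassLimitShortComplex K).g)) (add_zero n) := by
  have h := inflKS_map_comp_truncToClassKSD_comp_invariantsInclQuot (K := K) (S := S) f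
  have h' : (Ext.mk₀ ((inflKS K S).map (f ≫ truncToClassKSD K S))).comp
      (Ext.mk₀ (invariantsInclQuot (ramificationSubgroup K (↑S : Set (HeightOneSpectrum (𝓞 K)))) (classBarD K)))
        (zero_add 0) =
      Ext.mk₀ (sharp K S f ≫ (ideleClassLimitShortComplex K).g) := by
    exact (Ext.mk₀_comp_mk₀ _ _).trans (congrArg Ext.mk₀ h)
  exact (Ext.comp_assoc_of_second_deg_zero x _ _ (add_zero n)).trans (congrArg (fun z => x.comp z (add_zero n)) h')

variable {K S} in
/-- `Ext`-currency form of the square itself: composing a class with `[Inf(I_S → C_{K_S})]` and then with the counit is composing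
it with `[ι_S ≫ (J̄ ↠ C̄)]`. [cite: Harari2020, §4.3 Remark 4.24][cite: MilneADT2006, I §4 (p. 58)] -/
theorem ext_comp_mk₀_inflKS_map_truncToClassKSD_comp_mk₀_invariantsInclQuot {A : DiscreteRepCat ℤ (absoluteGaloisGroup K)} {n : ℕ}
    (x : Ext A ((inflKS K S).obj (truncIdeleBarD K S)) n) :
    (x.comp (Ext.mk₀ ((inflKS K S).map (truncToClassKSD K S))) (add_zero n)).comp
        (Ext.mk₀ (invariantsInclQuot (ramificationSubgroup K (↑S : Set (HeightOneSpectrum (𝓞 K)))) (classBarD K))) (add_zero n) =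
      x.comp (Ext.mk₀ (sharp K S (𝟙 (truncIdeleBarD K S)) ≫ (ideleClassLimitShortComplex K).g)) (add_zero n) := by
  have h := inflKS_map_truncToClassKSD_comp_invariantsInclQuot K S
  have h' : (Ext.mk₀ ((inflKS K S).map (truncToClassKSD K S))).comp
      (Ext.mk₀ (invariantsInclQuot (ramificationSubgroup K (↑S : Set (HeightOneSpectrum (𝓞 K)))) (classBarD K)))
        (zero_add 0) =
      Ext.mk₀ (sharp K S (𝟙 (truncIdeleBarD K S)) ≫ (ideleClassLimitShortComplex K).g) := by
    exact (Ext.mk₀_comp_mk₀ _ _).trans (congrArg Ext.mk₀ h)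
  exact (Ext.comp_assoc_of_second_deg_zero x _ _ (add_zero n)).trans (congrArg (fun z => x.comp z (add_zero n)) h')

end IdeleClassBar

end Literature.NumberTheory.GaloisRepresentations

end
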